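import Literature.Probability.LatticeModels.KLSConstantQuadrature
import Mathlib.Analysis.Convex.Mul
import HarnessLib

/-!
# A second-order kernel quadrature for Fröhlich–Israel–Lieb–Simon's constant of the layered dispersion:
# convexity of the heat-kernel integrand, the trapezoid (Hermite–Hadamard) cell bound, the trapezoid node sum,
# and a sharper node certificate

Topic `Literature/Probability/LatticeModels`, namespace `AnisotropicRotator`; companion of `KLSConstantQuadrature.lean`
(hubbard-tc-p2: certified node values `besselFactor_le_series` / `besselFactor_le_of_two_term`, the monotone LEFT-ENDPOINT
Riemann sum `setIntegral_Ioc_le_upperSum`, the tail `tripleF_tail_le`; evaluation `KLSConstantTenth.lean`). The object is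
Kennedy–Lieb–Shastry's `C(r) = (2π)⁻³∫d³p/(2 − cos p₁ − cos p₂ + r(1 − cos p₃))` ([KLS1988JSP] eq. (7), [FILS1978] (4.7);
tree `AnisotropicRotator.klsConstant`) in its heat-kernel form `C(r) = (2π)⁻³∫₀^∞ F_r`, `F_r(t) = B(t)²B(rt)`,
`B(s) = ∫_{-π}^{π} e^{−s(1−cos k)}dk` (`klsConstant_eq_integral`, `tripleF`). The left-endpoint rule is first order in the
mesh; near the infrared-bound threshold `C(r) = 2/π` (`r* ≈ 0.468` [float]) the margin is a per cent or two
(`C(1/2) = 0.62499` vs `0.63662`), which the first-order rule reaches only with thousands of nodes. This file supplies the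
second-order frame (used by `KLSConstantHalf.lean`):

* **`convexOn_besselFactor_comp_mul`, `convexOn_besselFactor`, `convexOn_tripleF`** — `s ↦ B(s·c)` and `B` are convex on
  `ℝ` (Laplace transforms of a positive measure: `e^{affine}` is convex, the integral is monotone and linear), hence so is
  `F_r = B·B·B(·r)` for `r ≥ 0` (Mathlib `ConvexOn.mul` for non-negative antitone — `besselFactor_antitone` — convex factors);
* **`setIntegral_Ioc_le_trapezoid`** — the upper half of the Hermite–Hadamard inequality for a convex integrand,
  `∫_{(a,b]} F ≤ (b − a)(F(a) + F(b))/2` (the chord lies above the graph; Mathlib carries the Jensen half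
  `ConvexOn.map_set_average_le` only);
* `trapSumPairs` (the trapezoid twin of `upperSumPairs`: `Σ_i (t_{i+1} − t_i)(u_i + u_{i+1})/2` over node/bound pairs with an
  endpoint bound `u_T`) and **`setIntegral_Ioc_le_mul_trapSumPairs`** — certified node bounds `F(t_i) ≤ c·u_i`, `F(T) ≤ c·u_T`
  give `∫_{(t_0,T]} F ≤ c·trapSumPairs T u_T ((t_i,u_i))` for convex `F`;
* **`besselFactor_le_of_laplace`** — a node certificate for `s ≥ 1` from the sharp-constant Laplace bound
  `besselFactor_le_laplace` (`B(s) ≤ √(2π/s) + A s^{−3/2} + πe^{−s}`, `A ≤ 3/5`) with `e^{−s} ≤ n!/sⁿ`: rational data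
  `a ≥ √(2π/s)`, `b ≤ √s`, `n` and `a + (3/5)/(sb) + 3.141593·n!/sⁿ ≤ 2·3.141592·v` give `B(s) ≤ 2πv` (the two-term node
  `besselFactor_le_of_two_term` has the `s^{−3/2}` coefficient `21/10`, which alone costs `≈ 0.003` on `C(1/2)`).

Everything is PROVED (std axioms); one plumbing `def` (`trapSumPairs`, a recursion over a list, like `upperSumPairs`); no number
of record. Cell use (`pub/hubbard-tc`, MO-S3, ASSUMPTIONS §0 K4 / §1 K4-a, comparison model only): the machinery of the kernel
decimal `C(1/2) ≤ 0.627` (`KLSConstantHalf.lean`) that moves the ordered side of the weak-interlayer («no-factor») window of the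
layered classical XY model to `J⊥ ≥ J∥/2`.

## References
* [FILS1978] J. Fröhlich, R. Israel, E. H. Lieb, B. Simon, Commun. Math. Phys. 62 (1978) 1–34, (4.7).
* [KLS1988JSP] T. Kennedy, E. H. Lieb, B. S. Shastry, J. Stat. Phys. 53 (1988) 1019–1030, eq. (7).
* [Hadamard1893] J. Hadamard, J. Math. Pures Appl. (4) 9 (1893) 171–215, p. 186 (with Ch. Hermite, Mathesis 3 (1883) 82):
  `f((a+b)/2) ≤ (b−a)⁻¹∫_a^b f ≤ (f(a)+f(b))/2` for convex `f` — the Hermite–Hadamard inequality; see also C. P. Niculescu,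
  L.-E. Persson, *Convex Functions and Their Applications*, Springer 2006, §1.9.
-/

noncomputable section

open MeasureTheory Set Real
open scoped Nat

namespace Literature.Probability.LatticeModels

namespace AnisotropicRotator

/-! ### Convexity -/

/-- **`s ↦ B(s·c)` is convex on `ℝ`** (`B(s) = ∫_{-π}^{π} e^{−s(1−cos k)}dk` is a Laplace transform of a positive
measure: `e^{affine}` is convex and the integral is monotone and linear). [cite: FILS1978, (4.7)] -/
theorem convexOn_besselFactor_comp_mul (c : ℝ) : ConvexOn ℝ univ (fun s : ℝ => besselFactor (s * c)) := by
  refine ⟨convex_univ, ?_⟩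
  intro x _ y _ a b ha hb hab
  simp only [smul_eq_mul]
  unfold besselFactor
  have hle : (-π : ℝ) ≤ π := by linarith [Real.pi_pos]
  have hcont : ∀ s : ℝ, Continuous fun k : ℝ => Real.exp (-(s * (1 - Real.cos k))) := fun s => by fun_prop
  have hix : IntervalIntegrable (fun k : ℝ => a * Real.exp (-(x * c * (1 - Real.cos k)))) volume (-π) π :=
    ((hcont (x * c)).intervalIntegrable _ _).const_mul a
  have hiy : IntervalIntegrable (fun k : ℝ => b * Real.exp (-(y * c * (1 - Real.cos k)))) volume (-π) π :=
    ((hcont (y * c)).intervalIntegrable _ _).const_mul b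
  rw [← intervalIntegral.integral_const_mul, ← intervalIntegral.integral_const_mul,
    ← intervalIntegral.integral_add hix hiy]
  refine intervalIntegral.integral_mono_on hle ((hcont ((a * x + b * y) * c)).intervalIntegrable _ _) (hix.add hiy)
    fun k _ => ?_
  have h := (convexOn_exp).2 (mem_univ (-(x * c * (1 - Real.cos k)))) (mem_univ (-(y * c * (1 - Real.cos k))))
    ha hb hab
  simp only [smul_eq_mul] at h
  have e : -((a * x + b * y) * c * (1 - Real.cos k)) =
      a * -(x * c * (1 - Real.cos k)) + b * -(y * c * (1 - Real.cos k)) := by ring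
  rw [e]
  exact h

/-- **`B` is convex on `ℝ`.** [cite: FILS1978, (4.7)] -/
theorem convexOn_besselFactor : ConvexOn ℝ univ besselFactor := by
  simpa using convexOn_besselFactor_comp_mul 1

/-- **`F_r = B·B·B(·r)` is convex on `ℝ` for `r ≥ 0`** (product of non-negative, non-increasing, convex functions).
[cite: FILS1978, (4.7)] -/
theorem convexOn_tripleF {r : ℝ} (hr : 0 ≤ r) : ConvexOn ℝ univ (tripleF r) := by
  have hB := convexOn_besselFactor
  have hBr := convexOn_besselFactor_comp_mul r
  have hB0 : ∀ ⦃x : ℝ⦄, x ∈ (univ : Set ℝ) → 0 ≤ besselFactor x := fun x _ => zero_le_besselFactor x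
  have hBr0 : ∀ ⦃x : ℝ⦄, x ∈ (univ : Set ℝ) → 0 ≤ (fun s : ℝ => besselFactor (s * r)) x :=
    fun x _ => zero_le_besselFactor _
  have hanti : AntitoneOn besselFactor univ := fun x _ y _ h => besselFactor_antitone h
  have hantir : AntitoneOn (fun s : ℝ => besselFactor (s * r)) univ :=
    fun x _ y _ h => besselFactor_antitone (mul_le_mul_of_nonneg_right h hr)
  have hBB : ConvexOn ℝ univ (besselFactor * besselFactor) := hB.mul hB hB0 hB0 (hanti.monovaryOn hanti)
  have hBB0 : ∀ ⦃x : ℝ⦄, x ∈ (univ : Set ℝ) → 0 ≤ (besselFactor * besselFactor) x :=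
    fun x _ => mul_nonneg (zero_le_besselFactor x) (zero_le_besselFactor x)
  have hantiBB : AntitoneOn (besselFactor * besselFactor) univ := fun x _ y _ h =>
    mul_le_mul (besselFactor_antitone h) (besselFactor_antitone h) (zero_le_besselFactor _) (zero_le_besselFactor _)
  have h3 := hBB.mul hBr hBB0 hBr0 (hantiBB.monovaryOn hantir)
  have e : tripleF r = (besselFactor * besselFactor) * fun s : ℝ => besselFactor (s * r) := by
    funext t; simp [tripleF, Pi.mul_apply]
  rw [e]
  exact h3

/-! ### The Hermite–Hadamard upper half on one cell -/

/-- **Trapezoid bound for a convex integrand** (the upper half of the Hermite–Hadamard inequality, proved here):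
`∫_{(a,b]} F ≤ (b − a)·(F(a) + F(b))/2` — the chord lies above a convex function. [cite: Hadamard1893, p. 186] -/
theorem setIntegral_Ioc_le_trapezoid {F : ℝ → ℝ} (hF : ConvexOn ℝ univ F) {a b : ℝ} (hab : a ≤ b)
    (hFi : IntegrableOn F (Ioc a b)) :
    ∫ t in Ioc a b, F t ≤ (b - a) * ((F a + F b) / 2) := by
  rcases eq_or_lt_of_le hab with rfl | hlt
  · simp
  have hba : 0 < b - a := sub_pos.2 hlt
  rw [← intervalIntegral.integral_of_le hab]
  have hFi' : IntervalIntegrable F volume a b := (intervalIntegrable_iff_integrableOn_Ioc_of_le hab).2 hFi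
  have hgc : Continuous fun t : ℝ => (b * F a - a * F b) / (b - a) + t * ((F b - F a) / (b - a)) := by fun_prop
  have hgi := hgc.intervalIntegrable (μ := volume) a b
  have hval : ∫ t in a..b, ((b * F a - a * F b) / (b - a) + t * ((F b - F a) / (b - a))) =
      (b - a) * ((F a + F b) / 2) := by
    rw [intervalIntegral.integral_add intervalIntegrable_const
        ((by fun_prop : Continuous fun t : ℝ => t * ((F b - F a) / (b - a))).intervalIntegrable _ _),
      intervalIntegral.integral_const, intervalIntegral.integral_mul_const, integral_id]
    simp only [smul_eq_mul]
    field_simp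
    ring
  calc ∫ t in a..b, F t ≤ ∫ t in a..b, ((b * F a - a * F b) / (b - a) + t * ((F b - F a) / (b - a))) :=
        intervalIntegral.integral_mono_on hab hFi' hgi fun t ht => ?_
    _ = (b - a) * ((F a + F b) / 2) := hval
  -- the chord bound at `t ∈ [a, b]`
  obtain ⟨hta, htb⟩ := ht
  have hθ1 : 0 ≤ (b - t) / (b - a) := div_nonneg (by linarith) hba.le
  have hθ2 : 0 ≤ (t - a) / (b - a) := div_nonneg (by linarith) hba.le
  have hθ : (b - t) / (b - a) + (t - a) / (b - a) = 1 := by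
    field_simp; ring
  have h := hF.2 (mem_univ a) (mem_univ b) hθ1 hθ2 hθ
  simp only [smul_eq_mul] at h
  have ht' : (b - t) / (b - a) * a + (t - a) / (b - a) * b = t := by
    field_simp; ring
  rw [ht'] at h
  refine h.trans (le_of_eq ?_)
  field_simp
  ring

/-! ### The trapezoid node sum -/

/-- The trapezoid sum with node BOUNDS: for pairs `(t_i, u_i)` (`t_0 ≤ t_1 ≤ … ≤ T`) and a bound `u_T` at `T`,
`Σ_i (t_{i+1} − t_i)·(u_i + u_{i+1})/2` with `t_{last+1} = T`, `u_{last+1} = u_T` (plumbing for the quadrature of the cited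
constant, the trapezoid twin of `upperSumPairs`). [cite: KLS1988JSP, eq. (7)] -/
def trapSumPairs (T uT : ℝ) : List (ℝ × ℝ) → ℝ
  | [] => 0
  | [p] => (T - p.1) * ((p.2 + uT) / 2)
  | p :: p' :: l => (p'.1 - p.1) * ((p.2 + p'.2) / 2) + trapSumPairs T uT (p' :: l)

/-- Unfolding `trapSumPairs` on two or more pairs (elementary quadrature bookkeeping for the cited constant, proved here).
[cite: KLS1988JSP, eq. (7)] -/
@[simp] theorem trapSumPairs_cons_cons (T uT : ℝ) (p p' : ℝ × ℝ) (l : List (ℝ × ℝ)) :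
    trapSumPairs T uT (p :: p' :: l) = (p'.1 - p.1) * ((p.2 + p'.2) / 2) + trapSumPairs T uT (p' :: l) := rfl

/-- Unfolding `trapSumPairs` on one pair (elementary quadrature bookkeeping for the cited constant, proved here).
[cite: KLS1988JSP, eq. (7)] -/
@[simp] theorem trapSumPairs_singleton (T uT : ℝ) (p : ℝ × ℝ) :
    trapSumPairs T uT [p] = (T - p.1) * ((p.2 + uT) / 2) := rfl

/-- **The trapezoid sum over certified nodes bounds the integral of a convex integrand**: if `F` is convex,
integrable on `(0, ∞)`, the nodes `0 ≤ t_0 ≤ t_1 ≤ … ≤ T` carry bounds `F(t_i) ≤ c·u_i` and `F(T) ≤ c·u_T`,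
then `∫_{(t_0, T]} F ≤ c · trapSumPairs T u_T ((t_i, u_i))` (the trapezoid rule cell by cell, `setIntegral_Ioc_le_trapezoid`;
elementary quadrature step for the cited constant, proved here). [cite: Hadamard1893, p. 186] [cite: KLS1988JSP, eq. (7)] -/
theorem setIntegral_Ioc_le_mul_trapSumPairs {F : ℝ → ℝ} (hF : ConvexOn ℝ univ F) (hFi : IntegrableOn F (Ioi 0))
    {c T uT : ℝ} (huT : F T ≤ c * uT) :
    ∀ (l : List (ℝ × ℝ)) (p : ℝ × ℝ), 0 ≤ p.1 → List.IsChain (fun x y : ℝ × ℝ => x.1 ≤ y.1) (p :: l) →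
      (∀ x ∈ p :: l, x.1 ≤ T) → (∀ x ∈ p :: l, F x.1 ≤ c * x.2) →
      ∫ t in Ioc p.1 T, F t ≤ c * trapSumPairs T uT (p :: l) := by
  intro l
  induction l with
  | nil =>
    intro p hp _ hT hB
    have hpT : p.1 ≤ T := hT p (by simp)
    have hFp : F p.1 ≤ c * p.2 := hB p (by simp)
    rw [trapSumPairs_singleton]
    have h1 := setIntegral_Ioc_le_trapezoid hF hpT
      (hFi.mono_set (Ioc_subset_Ioi_self.trans (Ioi_subset_Ioi hp)))
    have h2 : (T - p.1) * ((F p.1 + F T) / 2) ≤ (T - p.1) * ((c * p.2 + c * uT) / 2) :=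
      mul_le_mul_of_nonneg_left (by linarith) (by linarith)
    nlinarith
  | cons p' l ih =>
    intro p hp hch hT hB
    obtain ⟨hpp', hch'⟩ := List.isChain_cons_cons.1 hch
    have hp' : 0 ≤ p'.1 := hp.trans hpp'
    have hp'T : p'.1 ≤ T := hT p' (by simp)
    have hT' : ∀ x ∈ p' :: l, x.1 ≤ T := fun x hx => hT x (List.mem_cons_of_mem p hx)
    have hB' : ∀ x ∈ p' :: l, F x.1 ≤ c * x.2 := fun x hx => hB x (List.mem_cons_of_mem p hx)
    have hFp : F p.1 ≤ c * p.2 := hB p (by simp)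
    have hFp' : F p'.1 ≤ c * p'.2 := hB p' (by simp)
    have hI1 : IntegrableOn F (Ioc p.1 p'.1) := hFi.mono_set (Ioc_subset_Ioi_self.trans (Ioi_subset_Ioi hp))
    have hI2 : IntegrableOn F (Ioc p'.1 T) := hFi.mono_set (Ioc_subset_Ioi_self.trans (Ioi_subset_Ioi hp'))
    rw [trapSumPairs_cons_cons, ← Ioc_union_Ioc_eq_Ioc hpp' hp'T,
      setIntegral_union (Ioc_disjoint_Ioc.2 (by simp [hpp', hp'T])) measurableSet_Ioc hI1 hI2]
    have h1 := setIntegral_Ioc_le_trapezoid hF hpp' hI1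
    have h2 : (p'.1 - p.1) * ((F p.1 + F p'.1) / 2) ≤ (p'.1 - p.1) * ((c * p.2 + c * p'.2) / 2) :=
      mul_le_mul_of_nonneg_left (by linarith) (by linarith)
    have h3 := ih p' hp' hch' hT' hB'
    nlinarith

/-! ### A sharper node certificate for large arguments (Laplace bound with the `3/5` constant) -/

/-- `b₀ = 1/2 − π²/96 ≥ 25/64`. [folklore] -/
private theorem laplaceRate_ge' : (25 / 64 : ℝ) ≤ 1 / 2 - π ^ 2 / 96 := by
  nlinarith [Real.pi_lt_d2, Real.pi_pos]

/-- `A = (√π/32)·b₀^{-5/2} ≤ 3/5`. [folklore] -/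
private theorem laplaceConst_le' : Real.sqrt π / 32 * (1 / 2 - π ^ 2 / 96) ^ (-(5 / 2 : ℝ)) ≤ 3 / 5 := by
  have h0 : (0 : ℝ) < 1 / 2 - π ^ 2 / 96 := lt_of_lt_of_le (by norm_num) laplaceRate_ge'
  have h1 : (1 / 2 - π ^ 2 / 96) ^ (-(5 / 2 : ℝ)) ≤ (25 / 64 : ℝ) ^ (-(5 / 2 : ℝ)) :=
    Real.rpow_le_rpow_of_nonpos (by norm_num) laplaceRate_ge' (by norm_num)
  have h2 : (25 / 64 : ℝ) ^ (-(5 / 2 : ℝ)) = 32768 / 3125 := by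
    rw [Real.rpow_neg (by norm_num), show (5 / 2 : ℝ) = 2 + 1 / 2 by norm_num,
      Real.rpow_add (by norm_num), Real.rpow_two, ← Real.sqrt_eq_rpow,
      show (25 / 64 : ℝ) = (5 / 8) ^ 2 by norm_num, Real.sqrt_sq (by norm_num)]
    norm_num
  have h3 : Real.sqrt π ≤ 1.7725 := by
    have h : Real.sqrt π ≤ Real.sqrt (1.7725 ^ 2) :=
      Real.sqrt_le_sqrt (by nlinarith [Real.pi_lt_d4])
    rwa [Real.sqrt_sq (by norm_num)] at h
  have h4 : 0 ≤ (1 / 2 - π ^ 2 / 96) ^ (-(5 / 2 : ℝ)) := Real.rpow_nonneg h0.le _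
  calc Real.sqrt π / 32 * (1 / 2 - π ^ 2 / 96) ^ (-(5 / 2 : ℝ))
      ≤ 1.7725 / 32 * (32768 / 3125) := by
        rw [← h2]
        exact mul_le_mul (by linarith) h1 h4 (by norm_num)
    _ ≤ 3 / 5 := by norm_num

/-- **Certified node value from the Laplace bound**: for `s ≥ 1`, rationals `a ≥ √(2π/s)` (`2·3.141593 ≤ s a²`),
`0 < b ≤ √s` (`b² ≤ s`), `n ∈ ℕ` (`e^{−s} ≤ n!/sⁿ`) and `v` with `a + (3/5)/(s b) + 3.141593·n!/sⁿ ≤ 2·3.141592·v`: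
`B(s) ≤ 2πv` (`besselFactor_le_laplace` with `A ≤ 3/5`; sharper than the two-term node `besselFactor_le_of_two_term`
whose `s^{−3/2}` coefficient is `21/10`). [cite: FILS1978, (4.7)] -/
theorem besselFactor_le_of_laplace (n : ℕ) {s a b v : ℝ} (hs : 1 ≤ s) (ha : 0 ≤ a) (hb : 0 < b)
    (h1 : 2 * 3.141593 ≤ s * a ^ 2) (h2 : b ^ 2 ≤ s)
    (h3 : a + 3 / 5 / (s * b) + 3.141593 * ((n ! : ℝ) / s ^ n) ≤ 2 * 3.141592 * v) :
    besselFactor s ≤ 2 * π * v := by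
  have hs0 : 0 < s := by linarith
  have hπlo := Real.pi_gt_d6
  have hπhi := Real.pi_lt_d6
  have hπ0 := Real.pi_pos
  -- `√(2π/s) ≤ a`
  have hsq : Real.sqrt (2 * π / s) ≤ a := by
    rw [← Real.sqrt_sq ha]
    refine Real.sqrt_le_sqrt ?_
    rw [div_le_iff₀ hs0]
    nlinarith
  -- `s^{-3/2} ≤ 1/(s b)`
  have hsb : 0 < s * b := mul_pos hs0 hb
  have hroot : b ≤ Real.sqrt s := by
    rw [← Real.sqrt_sq hb.le]
    exact Real.sqrt_le_sqrt h2
  have hpow : s ^ (-(3 / 2 : ℝ)) ≤ 1 / (s * b) := by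
    have h32 : s ^ ((3 / 2 : ℝ)) = s * Real.sqrt s := by
      rw [show (3 / 2 : ℝ) = 1 + 1 / 2 by norm_num, Real.rpow_add hs0, Real.rpow_one, Real.sqrt_eq_rpow]
    rw [Real.rpow_neg hs0.le, h32, one_div]
    exact inv_anti₀ hsb (mul_le_mul_of_nonneg_left hroot hs0.le)
  -- `e^{-s} ≤ n!/s^n`
  have hexp : Real.exp (-s) ≤ (n ! : ℝ) / s ^ n := by
    have h := Real.pow_div_factorial_le_exp s hs0.le n
    have hn : (0 : ℝ) < n ! := by positivity
    have hsn : (0 : ℝ) < s ^ n := by positivity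
    rw [Real.exp_neg, inv_eq_one_div, div_le_div_iff₀ (Real.exp_pos s) hsn, one_mul]
    rw [div_le_iff₀ hn] at h
    linarith
  have hA := laplaceConst_le'
  have hA0 : 0 ≤ Real.sqrt π / 32 * (1 / 2 - π ^ 2 / 96) ^ (-(5 / 2 : ℝ)) :=
    mul_nonneg (by positivity) (Real.rpow_nonneg (lt_of_lt_of_le (by norm_num) laplaceRate_ge').le _)
  have hspos : 0 ≤ s ^ (-(3 / 2 : ℝ)) := Real.rpow_nonneg hs0.le _
  have hB := besselFactor_le_laplace hs0
  have hv : a ≤ 2 * 3.141592 * v := by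
    have : 0 ≤ 3 / 5 / (s * b) + 3.141593 * ((n ! : ℝ) / s ^ n) := by positivity
    linarith
  have hv0 : 0 ≤ v := by nlinarith
  calc besselFactor s
      ≤ Real.sqrt (2 * π / s) + Real.sqrt π / 32 * (1 / 2 - π ^ 2 / 96) ^ (-(5 / 2 : ℝ)) * s ^ (-(3 / 2 : ℝ)) +
        π * Real.exp (-s) := hB
    _ ≤ a + 3 / 5 * (1 / (s * b)) + 3.141593 * ((n ! : ℝ) / s ^ n) := by
        refine add_le_add (add_le_add hsq (mul_le_mul hA hpow hspos (by norm_num))) ?_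
        exact mul_le_mul hπhi.le hexp (Real.exp_pos _).le (by norm_num)
    _ = a + 3 / 5 / (s * b) + 3.141593 * ((n ! : ℝ) / s ^ n) := by ring
    _ ≤ 2 * 3.141592 * v := h3
    _ ≤ 2 * π * v := by nlinarith

end AnisotropicRotator

end Literature.Probability.LatticeModels

end
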